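import Literature.Combinatorics.Sahi2008.Percolation
import Literature.Combinatorics.Sahi2008.ProvedCases
import Summits.CriticalPhenomena.PercolationContinuityZ3.Theorems.PercNearOneGluingNoHeavyLowerTailSahiAbsorbedKahnStratum
import Mathlib.Tactic.Linarith
import Mathlib.Tactic.Ring
import HarnessLib

/-!
# Kahn's Conjecture 5 / Sahi's `C₃` on the PRINCIPAL-SANDWICH stratum, and the PINNED co-sunflower class law

Support file (seat `prim-masterthm-p1`, gen 14; `--supports stmt-CriticalPhenomena-4575`).  Pure proofs: no definition,
no `sorry`, standard axioms.  Memo `run/shared/lean/prim/prim-masterthm/FROM-prim-masterthm-p1-g14-PRINCIPAL-SANDWICH.md`.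

THE OBSERVATION.  For a nonnegative log-supermodular (FKG) weight `μ` on a finite distributive lattice with total mass
`Z`, up-sets `A, B`, and ANY finite set `C`, the tree's homogeneous third-order functional
`latticeE3 μ A B C = 2Z²·m(ABC) + m(A)m(B)m(C) − Z·(m(A)m(BC) + m(B)m(AC) + m(C)m(AB))` is LINEAR in the slot `C`
and splits along `I := A ∩ B` as (`latticeE3_eq_inner_sub_outer`)

  `latticeE3 μ A B C = [(Z − m(A))(Z − m(B)) + Z(Z − m(I))]·m(C ∩ I)`
  `                    − [Z·m(A)·m(B ∩ (C ∖ I)) + Z·m(B)·m(A ∩ (C ∖ I)) + (Z·m(I) − m(A)m(B))·m(C ∖ I)]`,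

with every bracket NONNEGATIVE (the last one by Harris–FKG, `fkg_upperSet_mass`).  Hence `C ↦ latticeE3 μ A B C` is
nondecreasing when `C` grows inside `A ∩ B` and shrinks outside it (`latticeE3_mono_slot`).  Comparing with a principal
up-set `↑w = {x | w ≤ x}`, for which `latticeE3 μ A B ↑w ≥ 0` is Sahi's Theorem 2 / Blinovsky (tree:
`Literature.Probability.LatticeModels.latticeE3_nonneg_of_principal`), gives

**THEOREM (`latticeE3_nonneg_of_principalSandwich`).**  If some `w` satisfies
`(i)` every `x ∈ C` outside `A ∩ B` has `w ≤ x`, and `(ii)` every `x ∈ A ∩ B` with `w ≤ x` lies in `C`,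
then `latticeE3 μ A B C ≥ 0` — Sahi's `E₃(1_A, 1_B, 1_C) ≥ 0`.  (`C` need not be increasing.)
It contains the tree's "containing" stratum (`A ∩ B ⊆ C`: take `w = ⊥`) and the principal slot (`C = ↑w`).

PRODUCT MEASURES (`kahn_sahiE3_nonneg_of_principalSandwich`): the same for increasing events `A, B ⊆ 2^ι`, any event `C`,
and a configuration `w : Set ι` with `C ∖ (A ∩ B) ⊆ {x | w ⊆ x}` and `{x ∈ A ∩ B | w ⊆ x} ⊆ C` — Kahn's Conjecture 5
[Kahn2022, Conj. 5] on this stratum.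

CO-SUNFLOWER COROLLARY (`coSunflower_nonneg_of_pinned`, the class law of the master-family programme = Sahi's `C₃` on
`(G₂ ∪ G₃, G₁ ∪ G₃, G₁ ∪ G₂)`): if a configuration `w` lies below every "only `G₁`" and every "only `G₂`" configuration and
below no "only `G₃`" configuration (PINNED petals), then `E₃(G₂∪G₃, G₁∪G₃, G₁∪G₂) ≥ 0`.  Example in none of the six strata
landed by gens 10–13 (atom-covering, union-OR, separated, majority-AND, inner/outer skeleton):
`G₁ = x₁x₂ ∨ x₃x₄`, `G₂ = x₁x₃ ∨ x₃x₄`, `G₃ = x₂x₃`, `w = {1}`.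
HONEST FRAMING: a new unconditional stratum with a five-line proof on top of two tree theorems (Harris, Sahi–Blinovsky
principal slot); Kahn's Conjecture 5, the co-sunflower class law in general, and `C_k` remain OPEN. [this work]
-/

namespace Summit.CriticalPhenomena.PercolationContinuityZ3.Theorems

namespace SahiPrincipalSandwich

open Finset
open Literature.Combinatorics.Sahi2008
open Literature.Probability.LatticeModels (mass mass_univ mass_nonneg mass_mono principalUp mem_principalUp
  isUpperSet_principalUp latticeE3 latticeE3_nonneg_of_principal fkg_upperSet_mass prodBernoulli sahiE3)
open Literature.Probability.Percolation.DecisionTree (ind)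

section Lattice

variable {α : Type*} [DistribLattice α] [Fintype α] [DecidableEq α]

omit [DistribLattice α] [Fintype α] in
/-- Mass splits along a subset: `m(C) = m(C ∩ I) + m(C ∖ I)`. [folklore] -/
theorem mass_eq_inter_add_sdiff (μ : α → ℝ) (C I : Finset α) : mass μ C = mass μ (C ∩ I) + mass μ (C \ I) := by
  unfold mass
  rw [← Finset.sum_sdiff (Finset.inter_subset_left : C ∩ I ⊆ C), Finset.sdiff_inter_self_left, add_comm]

omit [DistribLattice α] [Fintype α] in
/-- For `I ⊆ B`: `m(B ∩ C) = m(C ∩ I) + m(B ∩ (C ∖ I))`. [folklore] -/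
theorem mass_inter_eq_of_subset (μ : α → ℝ) {B C I : Finset α} (hIB : I ⊆ B) :
    mass μ (B ∩ C) = mass μ (C ∩ I) + mass μ (B ∩ (C \ I)) := by
  have h1 : C ∩ I ⊆ B ∩ C := by
    intro x hx
    rw [mem_inter] at hx ⊢
    exact ⟨hIB hx.2, hx.1⟩
  have h2 : (B ∩ C) \ (C ∩ I) = B ∩ (C \ I) := by
    ext x
    simp only [mem_sdiff, mem_inter, not_and]
    constructor
    · rintro ⟨⟨hB, hC⟩, h⟩
      exact ⟨hB, hC, h hC⟩
    · rintro ⟨hB, hC, hI⟩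
      exact ⟨⟨hB, hC⟩, fun _ => hI⟩
  unfold mass
  rw [← Finset.sum_sdiff h1, h2, add_comm]

omit [DistribLattice α] in
/-- **The slot decomposition of `latticeE3` along `I = A ∩ B`** (an identity, any weight): inner part with the coefficient
`(Z − m(A))(Z − m(B)) + Z(Z − m(A ∩ B))`, minus the outer part. [this work] -/
theorem latticeE3_eq_inner_sub_outer (μ : α → ℝ) (A B C : Finset α) :
    latticeE3 μ A B C =
      ((mass μ univ - mass μ A) * (mass μ univ - mass μ B) + mass μ univ * (mass μ univ - mass μ (A ∩ B))) *
          mass μ (C ∩ (A ∩ B)) -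
        (mass μ univ * mass μ A * mass μ (B ∩ (C \ (A ∩ B))) + mass μ univ * mass μ B * mass μ (A ∩ (C \ (A ∩ B))) +
          (mass μ univ * mass μ (A ∩ B) - mass μ A * mass μ B) * mass μ (C \ (A ∩ B))) := by
  have hABC : A ∩ B ∩ C = C ∩ (A ∩ B) := inter_comm _ _
  have hC := mass_eq_inter_add_sdiff μ C (A ∩ B)
  have hBC := mass_inter_eq_of_subset μ (C := C) (Finset.inter_subset_right : A ∩ B ⊆ B)
  have hAC := mass_inter_eq_of_subset μ (C := C) (Finset.inter_subset_left : A ∩ B ⊆ A)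
  unfold latticeE3
  rw [hABC, hC, hBC, hAC]
  ring

/-- **Monotonicity of the slot.**  For a nonnegative log-supermodular weight and up-sets `A, B`: if `C₁ ∩ (A ∩ B) ⊆ C₂` and
`C₂ ∖ (A ∩ B) ⊆ C₁`, then `latticeE3 μ A B C₁ ≤ latticeE3 μ A B C₂` (grow inside `A ∩ B`, shrink outside). [this work] -/
theorem latticeE3_mono_slot {μ : α → ℝ} (hμ₀ : 0 ≤ μ) (hμ : ∀ a b, μ a * μ b ≤ μ (a ⊓ b) * μ (a ⊔ b))
    {A B : Finset α} (hA : IsUpperSet (A : Set α)) (hB : IsUpperSet (B : Set α)) {C₁ C₂ : Finset α}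
    (hin : C₁ ∩ (A ∩ B) ⊆ C₂ ∩ (A ∩ B)) (hout : C₂ \ (A ∩ B) ⊆ C₁ \ (A ∩ B)) :
    latticeE3 μ A B C₁ ≤ latticeE3 μ A B C₂ := by
  rw [latticeE3_eq_inner_sub_outer μ A B C₁, latticeE3_eq_inner_sub_outer μ A B C₂]
  have hZ : 0 ≤ mass μ univ := mass_nonneg hμ₀ _
  have hmA : 0 ≤ mass μ A := mass_nonneg hμ₀ _
  have hmB : 0 ≤ mass μ B := mass_nonneg hμ₀ _
  have hAZ : mass μ A ≤ mass μ univ := mass_mono hμ₀ (subset_univ A)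
  have hBZ : mass μ B ≤ mass μ univ := mass_mono hμ₀ (subset_univ B)
  have hIZ : mass μ (A ∩ B) ≤ mass μ univ := mass_mono hμ₀ (subset_univ _)
  have hfkg : mass μ A * mass μ B ≤ mass μ univ * mass μ (A ∩ B) := fkg_upperSet_mass hμ₀ hμ hA hB
  have hk : 0 ≤ (mass μ univ - mass μ A) * (mass μ univ - mass μ B) + mass μ univ * (mass μ univ - mass μ (A ∩ B)) :=
    add_nonneg (mul_nonneg (sub_nonneg.2 hAZ) (sub_nonneg.2 hBZ)) (mul_nonneg hZ (sub_nonneg.2 hIZ))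
  have h1 : mass μ (C₁ ∩ (A ∩ B)) ≤ mass μ (C₂ ∩ (A ∩ B)) := mass_mono hμ₀ hin
  have h2 : mass μ (B ∩ (C₂ \ (A ∩ B))) ≤ mass μ (B ∩ (C₁ \ (A ∩ B))) :=
    mass_mono hμ₀ (inter_subset_inter Subset.rfl hout)
  have h3 : mass μ (A ∩ (C₂ \ (A ∩ B))) ≤ mass μ (A ∩ (C₁ \ (A ∩ B))) :=
    mass_mono hμ₀ (inter_subset_inter Subset.rfl hout)
  have h4 : mass μ (C₂ \ (A ∩ B)) ≤ mass μ (C₁ \ (A ∩ B)) := mass_mono hμ₀ hout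
  have t1 := mul_le_mul_of_nonneg_left h1 hk
  have t2 := mul_le_mul_of_nonneg_left h2 (mul_nonneg hZ hmA)
  have t3 := mul_le_mul_of_nonneg_left h3 (mul_nonneg hZ hmB)
  have t4 := mul_le_mul_of_nonneg_left h4 (sub_nonneg.2 hfkg)
  linarith

variable [DecidableLE α]

/-- **Sahi's `C₃` / Kahn's Conjecture 5 on the principal-sandwich stratum (lattice form).**  For a nonnegative
log-supermodular weight on a finite distributive lattice, up-sets `A, B`, ANY `C`, and some `w` with
(i) `x ∈ C`, `x ∉ A ∩ B` ⟹ `w ≤ x` and (ii) `x ∈ A ∩ B`, `w ≤ x` ⟹ `x ∈ C`:  `0 ≤ latticeE3 μ A B C`. [this work] -/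
theorem latticeE3_nonneg_of_principalSandwich {μ : α → ℝ} (hμ₀ : 0 ≤ μ)
    (hμ : ∀ a b, μ a * μ b ≤ μ (a ⊓ b) * μ (a ⊔ b)) {A B : Finset α} (hA : IsUpperSet (A : Set α))
    (hB : IsUpperSet (B : Set α)) (C : Finset α) (w : α) (hout : ∀ x ∈ C, x ∉ A ∩ B → w ≤ x)
    (hin : ∀ x ∈ A ∩ B, w ≤ x → x ∈ C) : 0 ≤ latticeE3 μ A B C := by
  refine le_trans (latticeE3_nonneg_of_principal hμ₀ hμ hA hB w) (latticeE3_mono_slot hμ₀ hμ hA hB ?_ ?_)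
  · intro x hx
    rw [mem_inter, mem_principalUp] at hx
    exact mem_inter.2 ⟨hin x hx.2 hx.1, hx.2⟩
  · intro x hx
    rw [mem_sdiff] at hx
    exact mem_sdiff.2 ⟨mem_principalUp.2 (hout x hx.1 hx.2), hx.2⟩

/-- The Sahi-functional form: `0 ≤ E₃(1_A, 1_B, 1_C)` for an FKG probability weight on the principal-sandwich stratum. [this work] -/
theorem sahiE_three_setInd_nonneg_of_principalSandwich {μ : α → ℝ} (hμ : IsFKGMeasure μ) {A B : Finset α}
    (hA : IsUpperSet (A : Set α)) (hB : IsUpperSet (B : Set α)) (C : Finset α) (w : α)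
    (hout : ∀ x ∈ C, x ∉ A ∩ B → w ≤ x) (hin : ∀ x ∈ A ∩ B, w ≤ x → x ∈ C) :
    0 ≤ sahiE μ 3 ![setInd A, setInd B, setInd C] := by
  rw [sahiE_three_indicator_eq_latticeE3 hμ.sum_eq_one]
  exact latticeE3_nonneg_of_principalSandwich hμ.nonneg hμ.mul_le_mul hA hB C w hout hin

end Lattice

/-! ### Product measures on `2^ι`: Kahn's Conjecture 5 on the stratum, and the PINNED co-sunflower class law -/

section Cube

open scoped Classical

variable {ι : Type} [Fintype ι]

/-- **Kahn's Conjecture 5 on the principal-sandwich stratum.**  For a product measure on a finite cube, increasing events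
`A, B`, any event `C`, and a configuration `w` such that every configuration of `C` outside `A ∩ B` contains `w` and every
configuration of `A ∩ B` containing `w` lies in `C`:  `E₃(A, B, C) ≥ 0`. [this work] -/
theorem kahn_sahiE3_nonneg_of_principalSandwich (p : ι → unitInterval) {A B : Set (Set ι)} (hA : IsUpperSet A)
    (hB : IsUpperSet B) (C : Set (Set ι)) (w : Set ι) (hout : ∀ x ∈ C, x ∉ A ∩ B → w ⊆ x)
    (hin : ∀ x ∈ A ∩ B, w ⊆ x → x ∈ C) : 0 ≤ sahiE3 (prodBernoulli p) A B C := by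
  rw [← sahiE_three_ind, SahiAbsorbed.ind_eq_setInd_toFinset, SahiAbsorbed.ind_eq_setInd_toFinset,
    SahiAbsorbed.ind_eq_setInd_toFinset]
  refine sahiE_three_setInd_nonneg_of_principalSandwich (isFKGMeasure_bernoulliWeight p) (by simpa using hA)
    (by simpa using hB) C.toFinset w (fun x hx hxI => hout x (by simpa using hx) (by simpa using hxI)) fun x hx hwx => ?_
  simpa using hin x (by simpa using hx) hwx

/-- The tree's "containing" stratum is the case `w = ∅`: `A ∩ B ⊆ C` ⟹ `E₃(A,B,C) ≥ 0`. [this work] -/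
theorem kahn_sahiE3_nonneg_of_inter_subset' (p : ι → unitInterval) {A B : Set (Set ι)} (hA : IsUpperSet A)
    (hB : IsUpperSet B) (C : Set (Set ι)) (hC : A ∩ B ⊆ C) : 0 ≤ sahiE3 (prodBernoulli p) A B C :=
  kahn_sahiE3_nonneg_of_principalSandwich p hA hB C ∅ (fun x _ _ => Set.empty_subset x) fun _ hx _ => hC hx

/-- **The PINNED co-sunflower class law.**  For increasing `G₁, G₂, G₃` and a configuration `w` lying below every
"only `G₁`" and every "only `G₂`" configuration and below no "only `G₃`" configuration,
`E₃(G₂ ∪ G₃, G₁ ∪ G₃, G₁ ∪ G₂) ≥ 0` (Sahi's `C₃` on this co-sunflower triple, every product measure). [this work] -/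
theorem coSunflower_sahiE3_nonneg_of_pinned (p : ι → unitInterval) {G₁ G₂ G₃ : Set (Set ι)} (h₁ : IsUpperSet G₁)
    (h₂ : IsUpperSet G₂) (h₃ : IsUpperSet G₃) (w : Set ι)
    (hpin : ∀ x, x ∈ G₁ ∪ G₂ → x ∉ G₃ → x ∉ G₁ ∩ G₂ → w ⊆ x) (hfree : ∀ x ∈ G₃, w ⊆ x → x ∈ G₁ ∪ G₂) :
    0 ≤ sahiE3 (prodBernoulli p) (G₂ ∪ G₃) (G₁ ∪ G₃) (G₁ ∪ G₂) := by
  refine kahn_sahiE3_nonneg_of_principalSandwich p (h₂.union h₃) (h₁.union h₃) (G₁ ∪ G₂) w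
    (fun x hx hxI => hpin x hx (fun h => hxI ⟨Or.inr h, Or.inr h⟩) fun h => hxI ⟨Or.inl h.2, Or.inl h.1⟩) ?_
  rintro x ⟨hxA, hxB⟩ hwx
  rcases hxA with h | h
  · exact Or.inr h
  · exact hfree x h hwx

/-- The PINNED class law in the programme's `sahiE`-dictionary form (`bernoulliWeight`, `ind`). [this work] -/
theorem coSunflower_nonneg_of_pinned (p : ι → unitInterval) {G₁ G₂ G₃ : Set (Set ι)} (h₁ : IsUpperSet G₁)
    (h₂ : IsUpperSet G₂) (h₃ : IsUpperSet G₃) (w : Set ι)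
    (hpin : ∀ x, x ∈ G₁ ∪ G₂ → x ∉ G₃ → x ∉ G₁ ∩ G₂ → w ⊆ x) (hfree : ∀ x ∈ G₃, w ⊆ x → x ∈ G₁ ∪ G₂) :
    0 ≤ sahiE (bernoulliWeight p) 3 ![ind (G₂ ∪ G₃), ind (G₁ ∪ G₃), ind (G₁ ∪ G₂)] := by
  rw [sahiE_three_ind]
  exact coSunflower_sahiE3_nonneg_of_pinned p h₁ h₂ h₃ w hpin hfree

end Cube

end SahiPrincipalSandwich

end Summit.CriticalPhenomena.PercolationContinuityZ3.Theorems
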